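import Literature.AlgebraicGeometry.Resolution.AlterationsCodimThreeNodalFormParts
import Literature.AlgebraicGeometry.Resolution.StalkIdealLemmas
import Literature.AlgebraicGeometry.Resolution.SemiStableCurvesReduced
import Literature.AlgebraicGeometry.Resolution.AlterationsLemma32
import Literature.AlgebraicGeometry.Resolution.AlterationsSemiStableCodimTwo
import Literature.AlgebraicGeometry.Resolution.ResolutionOfCurves
import Mathlib.AlgebraicGeometry.Geometrically.Reduced
import HarnessLib

/-!
# De Jong 1996, 3.5/4.24: the boundary at a singular point is `t₁ ⋯ t_r = 0` — `DeJong1996SemiStableNodalBoundary` discharged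

Topic: `Literature/AlgebraicGeometry/Resolution`. DISCHARGE of the named fact
`DeJong1996SemiStableNodalBoundary` (`AlterationsCodimThreeNodalFormParts.lean`; de Jong 1996,
3.5 "`D` at `s` is defined by `t₁ ⋯ t_r = 0`" with 4.23/4.24 "the sections `τᵢ` still map into
the smooth locus of `f`"): for a pair `(f : X → Y, g, D, τ)` in Situation 4.23 and a closed point
`x` of `X` with `𝒪_{X,x}` not regular, in any presentation
`e : 𝒪̂_{X,x} ≅ k⟦u, v, t⟧/(uv - ∏ tᵢ^{nnᵢ})` with `zᵢ ↦ tᵢ`, `z₁ ⋯ z_r` cutting out `D` at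
`f(x)`, the completed ideal of the boundary `Z = ⋃ τᵢ(Y) ∪ f⁻¹(D)` is `(t₁ ⋯ t_r)`.

Proof. (1) No section passes through `x`: the `τᵢ` land in the smooth locus of `f`, whose
points are regular points of `X` (`Y` regular; EGA IV₄ 17.5.8 (iii),
`SemiStablePair.isRegularLocalRing_stalk_apply`); so the stalk at `x` of the ideal of `Z` is that
of the ideal of `f⁻¹(D)` (`vanishingIdeal_sup`, `stalkIdeal_inf`). (2) The scheme-theoretic
inverse image `X ×_Y D_red` of the reduced `D` is REDUCED: `f` is flat with geometrically reduced
fibres (2.21, `IsSemiStableCurve.geometricallyReduced`) and `D_red` is reduced and locally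
Noetherian (Mathlib's `GeometricallyReduced.isReduced_of_flat_of_isLocallyNoetherian`); hence
the inverse image ideal sheaf `f⁻¹ I_D · 𝒪_X` is radical (`radical_eq_of_isReduced_subscheme`)
and equals the ideal of `f⁻¹(D)`; its stalk at `x` is `I_{D,f(x)} · 𝒪_{X,x} = (z₁ ⋯ z_r) 𝒪_{X,x}`
(`stalkIdeal_comap_eq_map_stalkMap`). (3) Extend to `𝒪̂_{X,x}` and apply `e`, `zᵢ ↦ tᵢ`.

* `isRadical_ideal_of_isReduced_subscheme`, `radical_eq_of_isReduced_subscheme`,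
  `isRadical_stalkIdeal_of_isReduced_subscheme` — an ideal sheaf with reduced closed subscheme is
  radical.
* `DeJong1996.SemiStablePair.isReduced_subscheme_comap_vanishingIdeal` — `f⁻¹(D_red)` is reduced.
* `DeJong1996.SemiStablePair.stalkIdeal_vanishingIdeal_boundary_of_not_isRegularLocalRing` —
  at a non-regular point, `I(Z)_x = I_{D,f(x)} · 𝒪_{X,x}` (cf. the general intersection formula
  `stalkIdeal_vanishingIdeal_semiStableBoundary` of `AlterationsBoundarySmoothLocus.lean`).
* `DeJong1996SemiStableNodalBoundary_holds` — THE DISCHARGE.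

## Sources

* A. J. de Jong, *Smoothness, semi-stability and alterations*, Publ. Math. IHÉS 83 (1996),
  2.21 (p. 61), 3.1, 3.5 (pp. 62–64), 4.23–4.24 (p. 75).
* A. Grothendieck, EGA IV₂ (flat morphisms with geometrically reduced fibres), IV₄ 17.5.8 (iii).
-/

noncomputable section

open CategoryTheory CategoryTheory.Limits AlgebraicGeometry TopologicalSpace Topology

namespace Literature.AlgebraicGeometry.Resolution

universe u

open IsLocalRing Scheme.IdealSheafData

/-! ## Ideal sheaves with reduced subscheme are radical -/

section Reduced

variable {X : Scheme.{u}}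

/-- If the closed subscheme of an ideal sheaf `J` is reduced, the ideals `J(U)` on affine opens
are radical (`J(U)` is the kernel of `Γ(X, U) → Γ(V(J) ∩ U) `, a reduced ring: chart
`Spec (Γ(X, U)/J(U))` of the subscheme). [folklore] -/
theorem isRadical_ideal_of_isReduced_subscheme (J : X.IdealSheafData) [IsReduced J.subscheme]
    (U : X.affineOpens) : (J.ideal U).IsRadical := by
  haveI : IsReduced (J.subschemeCover.openCover.X U) :=
    isReduced_of_isOpenImmersion (J.subschemeCover.openCover.f U)
  have h : IsReduced (Spec (.of (Γ(X, (U : X.Opens)) ⧸ J.ideal U))) := this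
  rw [affine_isReduced_iff] at h
  exact (Ideal.isRadical_iff_quotient_reduced _).mpr h

/-- An ideal sheaf whose closed subscheme is reduced is a radical ideal sheaf. [folklore] -/
theorem radical_eq_of_isReduced_subscheme (J : X.IdealSheafData) [IsReduced J.subscheme] :
    J.radical = J := by
  ext U : 2
  rw [radical_ideal]
  exact (isRadical_ideal_of_isReduced_subscheme J U).radical

/-- Stalk form: the stalks of an ideal sheaf with reduced closed subscheme are radical ideals.
[folklore] -/
theorem isRadical_stalkIdeal_of_isReduced_subscheme (J : X.IdealSheafData) [IsReduced J.subscheme]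
    (x : X) : (stalkIdeal J x).IsRadical := by
  rw [← Ideal.radical_eq_iff, ← stalkIdeal_radical, radical_eq_of_isReduced_subscheme]

end Reduced

/-! ## The inverse image of the reduced `D` is reduced; the ideal of `Z` at a singular point -/

namespace DeJong1996.SemiStablePair

variable {k : Type u} [Field k] {X Y : Scheme.{u}} {f : X ⟶ Y} {g : Y ⟶ Spec (.of k)}
  {D : Set Y} {n : ℕ} {τ : Fin n → (Y ⟶ X)}

/-- **`f⁻¹(D_red)` is reduced** for a pair in Situation 4.23: `f` is flat with geometrically
reduced fibres (the fibres of a semi-stable curve are geometrically reduced, 2.21) and the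
reduced closed subscheme `D_red ⊆ Y` is reduced and locally Noetherian, so
`X ×_Y D_red` — the closed subscheme of the inverse image ideal sheaf `f⁻¹ I_D · 𝒪_X` — is
reduced. [cite: DeJong1996, 2.21, p. 61] -/
theorem isReduced_subscheme_comap_vanishingIdeal (hS : SemiStablePair f g D τ) (Z : Closeds Y) :
    IsReduced ((vanishingIdeal Z).comap f).subscheme := by
  haveI := hS.isNoetherian_base
  haveI : Flat f := hS.isSemiStableCurve.flat
  haveI : GeometricallyReduced f := hS.isSemiStableCurve.geometricallyReduced
  haveI : IsReduced (vanishingIdeal Z).subscheme := isReduced_subscheme_vanishingIdeal Z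
  haveI : IsLocallyNoetherian (vanishingIdeal Z).subscheme :=
    LocallyOfFiniteType.isLocallyNoetherian (vanishingIdeal Z).subschemeι
  haveI : IsReduced (pullback f (vanishingIdeal Z).subschemeι) := inferInstance
  exact isReduced_of_isOpenImmersion ((vanishingIdeal Z).comapIso f).hom

/-- **The ideal of the boundary at a singular point** (de Jong 1996, 3.5 with 4.23/4.24): for a
pair in Situation 4.23 and a point `x` of `X` with `𝒪_{X,x}` not regular, the stalk at `x` of
the ideal sheaf of (the reduced structure on) `Z = ⋃ᵢ τᵢ(Y) ∪ f⁻¹(D)` is the extension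
`I_{D,f(x)} · 𝒪_{X,x}` of the stalk at `f(x)` of the ideal sheaf of `D`: no section passes
through `x` (the `τᵢ` land in the smooth locus, which is regular), and `f⁻¹ I_D · 𝒪_X` is
radical (`isReduced_subscheme_comap_vanishingIdeal`), hence equal to the ideal of `f⁻¹(D)`.
[cite: DeJong1996, 3.5 and 4.24, pp. 64, 75] -/
theorem stalkIdeal_vanishingIdeal_boundary_of_not_isRegularLocalRing (hS : SemiStablePair f g D τ)
    {x : X} (hx : ¬ IsRegularLocalRing (X.presheaf.stalk x)) :
    stalkIdeal (vanishingIdeal ⟨semiStableBoundary f D τ, hS.isClosed_semiStableBoundary⟩) x =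
      (stalkIdeal (vanishingIdeal ⟨D, hS.isStrictNormalCrossingsDivisor.isClosed⟩) (f x)).map
        (f.stalkMap x).hom := by
  -- the closed pieces of `Z`
  let Dc : Closeds Y := ⟨D, hS.isStrictNormalCrossingsDivisor.isClosed⟩
  have hSc : IsClosed (⋃ i, Set.range (τ i)) := by
    refine isClosed_iUnion_of_finite fun i => ?_
    haveI := hS.isClosedImmersion i
    exact (τ i).isClosedEmbedding.isClosed_range
  let S : Closeds X := ⟨⋃ i, Set.range (τ i), hSc⟩
  have hZ : (⟨semiStableBoundary f D τ, hS.isClosed_semiStableBoundary⟩ : Closeds X) =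
      S ⊔ Dc.preimage f.continuous := by
    ext y
    simp only [Closeds.coe_mk, Closeds.coe_sup, Closeds.coe_preimage, Set.mem_union,
      mem_semiStableBoundary_iff, Set.mem_iUnion, Set.mem_preimage, S, Dc]
  -- (1) no section passes through `x`
  have hxS : x ∉ (S : Set X) := by
    intro hxS'
    obtain ⟨i, y', hy'⟩ := Set.mem_iUnion.mp hxS'
    exact hx (hy' ▸ hS.isRegularLocalRing_stalk_apply i y')
  have hxS' : x ∉ (vanishingIdeal S).support := by
    rw [← SetLike.mem_coe, coe_support_vanishingIdeal]
    exact hxS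
  rw [hZ, vanishingIdeal_sup, stalkIdeal_inf, stalkIdeal_eq_top_of_not_mem_support hxS',
    top_inf_eq, stalkIdeal_vanishingIdeal_preimage, ← stalkIdeal_comap_eq_map_stalkMap]
  -- (2) `f⁻¹ I_D · 𝒪_X` is radical
  haveI := hS.isReduced_subscheme_comap_vanishingIdeal Dc
  exact (isRadical_stalkIdeal_of_isReduced_subscheme _ x).radical

end DeJong1996.SemiStablePair

/-! ## The discharge -/

/-- DISCHARGE of `DeJong1996SemiStableNodalBoundary` (de Jong 1996, 3.5 "`D` at `s` is defined by
`t₁ ⋯ t_r = 0`", with 4.23/4.24): in a presentation `e : 𝒪̂_{X,x} ≅ k⟦u, v, t⟧/(uv - ∏ tᵢ^{nnᵢ})`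
with `zᵢ ↦ tᵢ` at a closed non-regular point, where `(z₁ ⋯ z_r)` is the stalk of the ideal of
`D` at `f(x)`, the completed ideal of `Z` goes to `(t₁ ⋯ t_r)`:
`Î_Z = I_{D,f(x)} 𝒪̂_{X,x} = (z₁ ⋯ z_r) 𝒪̂_{X,x}` (`stalkIdeal_vanishingIdeal_boundary_of_not_isRegularLocalRing`)
and `e(z₁ ⋯ z_r) = t₁ ⋯ t_r`. [cite: DeJong1996, 3.5, p. 64] -/
theorem DeJong1996SemiStableNodalBoundary_holds : DeJong1996SemiStableNodalBoundary.{u} := by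
  intro k _ _ X Y f g D n τ d hS hd x hx hreg r z nn e hD he U hU
  classical
  rw [completedStalkIdeal_eq_map_stalkIdeal,
    hS.stalkIdeal_vanishingIdeal_boundary_of_not_isRegularLocalRing hreg, hD, Ideal.map_span, Set.image_singleton, Ideal.map_span, Set.image_singleton, Ideal.map_span,
    Set.image_singleton]
  refine congrArg (fun a => Ideal.span {a}) ?_
  rw [map_prod, map_prod, RingEquiv.toRingHom_eq_coe, RingHom.coe_coe, map_prod,
    DeJong1996.nodalPowBoundary, map_prod]
  exact Finset.prod_congr rfl fun i _ => he i

end Literature.AlgebraicGeometry.Resolution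

end
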